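/-
Copyright: derived here (Resolution Observatory cell `pub-rosobs`, carver gen 45). AI-written Lean; AI review is
weaker than expert review.  Typed statements in the cell's POLYNOMIAL weighted-centre model `W(f)` — an instrument,
NOT a resolution theorem and NOT a statement about the invariant of [AbramovichTemkinWlodarczyk2024] on power series.
-/
import Literature.AlgebraicGeometry.Resolution.WeightedCentreBentFamily
import HarnessLib

/-!
# The rank-one bent family `x^q + y3^{q/p} + y1^p − y2^{mp} y3`: a `T`-tight AND a bent maximal centre

Companion to `WeightedCentreBentFamily` (the case `a ≥ 2`).  For an integer `p ≥ 2`, `m ≥ 1`, `q = p^{c+1}` with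
`q/p = p^c > mp + 1` put `ℓ := y1^p − y2^{mp} y3` (`bentEll`), `h₁ := y3^{q/p} + ℓ` (`bentH₁`), `F₁ := x^q + h₁`
(`bentF₁`) and `γ₁ := (0; 1/p, 1/(mp+1), 1/(mp+1))` (`bentWeights₁`).  This is the case `a = 1` of the cell's bent
family (engine-1 gen 28, Theorem 3 there): here the maximal invariant is attained BOTH by a `T`-tight centre
(`y1 ↦ y1 + x^{q/p}`, `tightShear`) and by the bent centre (`y3 ↦ y3 + x^p` then `y1 ↦ y1 + x y2^m`, `bentShear`).

## Main statements

* `tightShear_symm_bentF₁`, `bentShear_symm_bentF₁` : in characteristic `p`, `Ψ_T⁻¹ F₁ = h₁ = Ψ_B⁻¹ F₁`.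
* `isCentreFor_tight₁`, `isCentreFor_bent₁` : both `(Ψ_T, γ₁)` and `(Ψ_B, γ₁)` are centres for `F₁`;
  `isTTight_tightShear` : `Ψ_T` is `T`-tight; `not_isTTight_bent₁` : `Ψ_B` is not (`1/q + m/(mp+1) < 1/p`).
* `monomialOrd_one_bentH₁`, `homogeneousComponent_bentH₁`, `hironakaDelta_bentH₁`, `deltaInitial_bentH₁`,
  `hironakaTau_bentEll` : over EVERY field, `ord h₁ = p`, `in h₁ = y1^p`, `δ(h₁; x,y2,y3; y1) = (mp+1)/p ∉ ℕ`,
  `in_δ h₁ = ℓ`, `τ(ℓ) = 3`.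
* `isMaxInv_bentH₁` (every field, every integer `p ≥ 2`) and **`isMaxInv_bentF₁`** (characteristic `p`):
  `max W(F₁) = max W(h₁) = (p, mp+1, mp+1)`.
* **`exists_isTTight_and_not_isTTight_centre`** : `F₁` has two centres of maximal invariant with the same weights,
  one `T`-tight and one not (the cell's Theorem 3, typed for every prime `p`; its example is
  `isMaxInv_bent_2_1_1_8` : `max W(x^8 + y3^4 + y1^2 + y2^2 y3) = (2, 3, 3)` in characteristic `2`).
* `bentFace_eq_bentEll_pow` : the `a ≥ 2` face is `ℓ^{p^{a−1}} + y2^n ℓ^{p^{a−2}}`.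

The model has no notion of equality of centres beyond the presentation `(Ψ, γ)`; "two maximal centres" is typed as
"a `T`-tight maximal presentation and a non-`T`-tight one".  Instrument value only.

## References

[cite: AbramovichTemkinWlodarczyk2024, §5.1 (p. 1575), Lemma 5.2.10 (p. 1577), Thm. 5.3.1 (2)–(3) (p. 1578)] ·
[cite: CossartJannsenSaito2020, Def. 1.26 / Lemma 1.27, Def. 8.1–8.2 (pp. 117–118), Thm. 8.16 (p. 121), Thm. 8.22 (a) (p. 124)] ·
[cite: Hauser2010, §C (p. 9), §D (p. 12)] · [cite: AbramovichQuekSchober2025, Thm. 3.5].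
-/

noncomputable section

open MvPolynomial

namespace Literature.AlgebraicGeometry.Resolution.WeightedBlowup

variable {k : Type*} [Field k]

/-! ## §1 The family, the two coordinate changes and the weights -/

section RankOne

variable (k) in
/-- `ℓ = y1^p − y2^{mp} y3`: the purely inseparable form with its `𝔾_a`-symmetry `(y1, y3) ↦ (y1 + x y2^m, y3 + x^p)`.
(cell's family, engine-1 gen 28) [cite: Hauser2010, §C (p. 9) (purely inseparable `x^p + h`)] -/
def bentEll (p m : ℕ) : MvPolynomial (Fin 4) k := X 1 ^ p - X 2 ^ (m * p) * X 3

variable (k) in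
/-- `h₁ = y3^{q/p} + ℓ` (`q/p = p^c`). (cell's family, `a = 1`) [cite: Hauser2010, §C (p. 9) (the residual polynomial `h` of `x^p + h`)] -/
def bentH₁ (p m c : ℕ) : MvPolynomial (Fin 4) k := X 3 ^ p ^ c + bentEll k p m

variable (k) in
/-- `F₁ = x^q + h₁`, `q = p^{c+1}`. (cell's family, `a = 1`) [cite: Hauser2010, §C (p. 9)] -/
def bentF₁ (p m c : ℕ) : MvPolynomial (Fin 4) k := X 0 ^ p ^ (c + 1) + bentH₁ k p m c

variable (k) in
/-- **The `T`-tight coordinate change** `Ψ_T : y1 ↦ y1 + x^{q/p}` (maximal contact for `y1`, then absorb `x^q`).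
[cite: CossartJannsenSaito2020, Def. 8.2 / Thm. 8.16 (p. 121) (coordinate changes `y ↦ y + q(u)`)] -/
def tightShear (p c : ℕ) : MvPolynomial (Fin 4) k ≃ₐ[k] MvPolynomial (Fin 4) k := addPolyShear 1 (X 0 ^ p ^ c)

/-- The weights `γ₁ = (0; 1/p, 1/(mp+1), 1/(mp+1))`. [cite: AbramovichTemkinWlodarczyk2024, §5.1 and Thm. 5.3.1 (2) (p. 1578)] -/
def bentWeights₁ (p m : ℕ) : Fin 4 → ℚ := umbrellaWeights 1 2 3 p (m * p)

variable {p m c : ℕ}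

/-- The `a ≥ 2` face in terms of `ℓ`: `Φ = ℓ^{p^{a−1}} + y2^n ℓ^{p^{a−2}}` (characteristic `p`). (derived here)
[cite: CossartJannsenSaito2020, Def. 8.2 (4) (p. 118)] -/
theorem bentFace_eq_bentEll_pow [Fact p.Prime] [CharP k p] (b m : ℕ) :
    bentFace k p b m = bentEll k p m ^ p ^ (b + 1) + X 2 ^ bentN p b m * bentEll k p m ^ p ^ b :=
  bentFace_eq_factored b m

/-! ### §1.1 The three monomials of `h₁` -/

/-- `h₁` as a signed sum of three monomials. (derived here) [cite: CossartJannsenSaito2020, Def. 8.2 (p. 118)] -/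
theorem bentH₁_eq_monomial (p m c : ℕ) : bentH₁ k p m c =
    monomial (expFin4 0 0 0 (p ^ c)) 1 + (monomial (expFin4 0 p 0 0) 1 - monomial (expFin4 0 0 (m * p) 1) 1) := by
  simp only [bentH₁, bentEll, monomial_expFin4, pow_zero, pow_one, one_mul, mul_one]

/-- **Coefficients of `h₁`.** (derived here) [cite: CossartJannsenSaito2020, Def. 8.2 (p. 118)] -/
theorem coeff_bentH₁ (p m c : ℕ) (d : Fin 4 →₀ ℕ) : coeff d (bentH₁ k p m c) =
    (if expFin4 0 0 0 (p ^ c) = d then 1 else 0) +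
      ((if expFin4 0 p 0 0 = d then 1 else 0) - (if expFin4 0 0 (m * p) 1 = d then 1 else 0)) := by
  rw [bentH₁_eq_monomial]
  simp only [coeff_add, coeff_sub, coeff_monomial]

/-- **The support of `h₁`.** (derived here) [cite: CossartJannsenSaito2020, Def. 8.2 (p. 118)] -/
theorem support_bentH₁_subset (p m c : ℕ) : (bentH₁ k p m c).support ⊆
    {expFin4 0 0 0 (p ^ c), expFin4 0 p 0 0, expFin4 0 0 (m * p) 1} := by
  intro d hd
  simp only [Finset.mem_insert, Finset.mem_singleton]
  by_contra h
  simp only [not_or] at h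
  obtain ⟨h0, h1, h2⟩ := h
  rw [mem_support_iff, coeff_bentH₁, if_neg (Ne.symm h0), if_neg (Ne.symm h1), if_neg (Ne.symm h2)] at hd
  simp at hd

/-- The coefficient of `y1^p` in `h₁` is `1` (plumbing). [folklore] -/
private theorem coeff_e1_bentH₁₄₅ (hp : 2 ≤ p) (m c : ℕ) : coeff (expFin4 0 p 0 0) (bentH₁ k p m c) = 1 := by
  rw [coeff_bentH₁, if_neg, if_pos rfl, if_neg]
  · simp
  all_goals (rw [expFin4_eq_iff]; omega)

/-- The coefficient of `y2^{mp} y3` in `h₁` is `−1` (plumbing). [folklore] -/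
private theorem coeff_e2_bentH₁₄₅ (hp : 2 ≤ p) (hq : m * p + 1 < p ^ c) :
    coeff (expFin4 0 0 (m * p) 1) (bentH₁ k p m c) = -1 := by
  rw [coeff_bentH₁, if_neg, if_neg, if_pos rfl]
  · simp
  all_goals (rw [expFin4_eq_iff]; omega)

/-! ### §1.2 The two coordinate changes carry `F₁` to `h₁` -/

/-- `y1 ∉ vars (x^{q/p})` (plumbing). [folklore] -/
private theorem one_notMem_vars_X_pow₄₅ (e : ℕ) : (1 : Fin 4) ∉ (X 0 ^ e : MvPolynomial (Fin 4) k).vars := by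
  intro h
  have := vars_pow _ _ h
  rw [vars_X] at this
  exact absurd (Finset.mem_singleton.1 this) (by decide)

/-- `Ψ_T⁻¹(y1) = y1 − x^{q/p}`. (derived here) [cite: CossartJannsenSaito2020, Def. 8.2 (p. 118)] -/
theorem tightShear_symm_X_one (p c : ℕ) : (tightShear k p c).symm (X 1) = X 1 - X 0 ^ p ^ c := by
  rw [tightShear]
  simp [addPolyShear, sub_eq_add_neg, killVar_eq_self_of_notMem (one_notMem_vars_X_pow₄₅ (k := k) (p ^ c))]

/-- `Ψ_T⁻¹` fixes `x, y2, y3`. (derived here) [cite: CossartJannsenSaito2020, Def. 8.2 (p. 118)] -/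
theorem tightShear_symm_X_of_ne (p c : ℕ) {x : Fin 4} (hx : x ≠ 1) : (tightShear k p c).symm (X x) = X x := by
  rw [tightShear]
  simp [addPolyShear, hx]

/-- `Ψ_T` fixes the origin. (derived here) [cite: AbramovichTemkinWlodarczyk2024, Lemma 5.2.10 (p. 1577)] -/
theorem constantCoeff_tightShear_X (hp : 1 ≤ p) (c : ℕ) (i : Fin 4) :
    constantCoeff (tightShear k p c (X i)) = 0 :=
  constantCoeff_addPolyShear_X 1 (by rw [map_pow, constantCoeff_X, zero_pow (by positivity)]) i

/-- **`Ψ_T⁻¹ F₁ = h₁`**: `(y1 − x^{q/p})^p = y1^p − x^q` absorbs `x^q`. (derived here)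
[cite: CossartJannsenSaito2020, Thm. 8.16 (p. 121)] -/
theorem tightShear_symm_bentF₁ [hp : Fact p.Prime] [CharP k p] (m c : ℕ) :
    (tightShear k p c).symm (bentF₁ k p m c) = bentH₁ k p m c := by
  simp only [bentF₁, bentH₁, bentEll, map_add, map_sub, map_mul, map_pow, tightShear_symm_X_one,
    tightShear_symm_X_of_ne p c (show (0 : Fin 4) ≠ 1 by decide),
    tightShear_symm_X_of_ne p c (show (2 : Fin 4) ≠ 1 by decide),
    tightShear_symm_X_of_ne p c (show (3 : Fin 4) ≠ 1 by decide)]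
  rw [sub_pow_char (p := p)]
  simp only [← pow_mul]
  ring

/-- **`Ψ_B⁻¹ F₁ = h₁`**: `(y3 − x^p)^{q/p} = y3^{q/p} − x^q` absorbs `x^q` and `ℓ(y1 − x y2^m, y2, y3 − x^p) = ℓ`.
(derived here; the cell's bent centre for `a = 1`) [cite: CossartJannsenSaito2020, Thm. 8.16 (p. 121)]
[cite: Hauser2010, §D (p. 12) (coordinate changes mixing `x` into `y`)] -/
theorem bentShear_symm_bentF₁ [hp : Fact p.Prime] [CharP k p] (m c : ℕ) :
    (bentShear k p m).symm (bentF₁ k p m c) = bentH₁ k p m c := by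
  simp only [bentF₁, bentH₁, bentEll, map_add, map_sub, map_mul, map_pow, bentShear_symm_X_zero,
    bentShear_symm_X_one, bentShear_symm_X_two, bentShear_symm_X_three]
  rw [sub_pow_char_pow (p := p), sub_pow_char (p := p)]
  simp only [mul_pow, ← pow_mul]
  ring

/-- Hence **`W(F₁) = W(h₁)`** in characteristic `p`. (derived here)
[cite: AbramovichTemkinWlodarczyk2024, Thm. 5.3.1 (3) (p. 1578) (independence of coordinates)] -/
theorem admissibleInvariants_bentF₁ [hp : Fact p.Prime] [CharP k p] (m c : ℕ) :
    admissibleInvariants (bentF₁ k p m c) = admissibleInvariants (bentH₁ k p m c) := by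
  have h : bentF₁ k p m c = bentShear k p m (bentH₁ k p m c) := by
    rw [← bentShear_symm_bentF₁, AlgEquiv.apply_symm_apply]
  rw [h, admissibleInvariants_map_eq _ (constantCoeff_bentShear_X hp.out.one_lt.le m)]

/-! ### §1.3 The weights: values, `exps`, admissibility -/

/-- `γ₁(x) = 0`. [cite: AbramovichTemkinWlodarczyk2024, §5.1] -/
theorem bentWeights₁_zero (p m : ℕ) : bentWeights₁ p m 0 = 0 := by
  simp [bentWeights₁, umbrellaWeights]

/-- `γ₁(y1) = 1/p`. [cite: AbramovichTemkinWlodarczyk2024, §5.1] -/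
theorem bentWeights₁_one (p m : ℕ) : bentWeights₁ p m 1 = (p : ℚ)⁻¹ := by
  simp [bentWeights₁, umbrellaWeights]

/-- `γ₁(y2) = 1/(mp+1)`. [cite: AbramovichTemkinWlodarczyk2024, §5.1] -/
theorem bentWeights₁_two (p m : ℕ) : bentWeights₁ p m 2 = (((m * p + 1 : ℕ) : ℚ))⁻¹ := by
  simp [bentWeights₁, umbrellaWeights]

/-- `γ₁(y3) = 1/(mp+1)`. [cite: AbramovichTemkinWlodarczyk2024, §5.1] -/
theorem bentWeights₁_three (p m : ℕ) : bentWeights₁ p m 3 = (((m * p + 1 : ℕ) : ℚ))⁻¹ := by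
  simp [bentWeights₁, umbrellaWeights]

/-- `γ₁ ≥ 0` (plumbing). [folklore] -/
private theorem bentWeights₁_nonneg₄₅ (p m : ℕ) (i : Fin 4) : 0 ≤ bentWeights₁ p m i := by
  unfold bentWeights₁ umbrellaWeights
  split_ifs <;> positivity

/-- **`exps γ₁ = (p, mp+1, mp+1)`.** (derived here) [cite: AbramovichTemkinWlodarczyk2024, Thm. 5.3.1 (2) (p. 1578)] -/
theorem exps_bentWeights₁ (hp : 1 ≤ p) (hm : 1 ≤ m) :
    exps (bentWeights₁ p m) = [(p : ℚ), ((m * p + 1 : ℕ) : ℚ), ((m * p + 1 : ℕ) : ℚ)] := by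
  have h : p ≤ m * p := Nat.le_mul_of_pos_left p hm
  rw [bentWeights₁, exps_umbrellaWeights (by decide) (by decide) (by decide) (by positivity) (by omega)]

/-- `w = (0; mp+1, p, p) = p(mp+1)·γ₁` (plumbing). [cite: AbramovichTemkinWlodarczyk2024, Rem. 2.4.2 (p. 1568)] -/
private theorem bentW_eq_mul_bentWeights₁₄₅ (hp : 1 ≤ p) (m : ℕ) (i : Fin 4) :
    ((bentW p m i : ℕ) : ℚ) = ((p * (m * p + 1) : ℕ) : ℚ) * bentWeights₁ p m i := by
  have hpq : (p : ℚ) ≠ 0 := by positivity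
  have hMq : ((m * p + 1 : ℕ) : ℚ) ≠ 0 := by positivity
  fin_cases i
  · simp [bentW, bentWeights₁_zero]
  · simp only [bentW, Fin.mk_one, Fin.isValue, one_ne_zero, if_false, if_true, bentWeights₁_one, Nat.cast_mul,
      mul_comm (p : ℚ), mul_inv_cancel_right₀ hpq]
  · simp only [bentW, Fin.reduceFinMk, Fin.isValue, show (2 : Fin 4) ≠ 0 by decide, show (2 : Fin 4) ≠ 1 by decide,
      if_false, bentWeights₁_two, Nat.cast_mul, mul_inv_cancel_right₀ hMq]
  · simp only [bentW, Fin.reduceFinMk, Fin.isValue, show (3 : Fin 4) ≠ 0 by decide, show (3 : Fin 4) ≠ 1 by decide,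
      if_false, bentWeights₁_three, Nat.cast_mul, mul_inv_cancel_right₀ hMq]

/-- **`γ₁` is admissible for `h₁`**: the three monomials have `w`-weight `p·p^c, p(mp+1), p(mp+1) ≥ p(mp+1)`.
(derived here) [cite: AbramovichTemkinWlodarczyk2024, Thm. 5.3.1 (2) (p. 1578), Lemma 5.2.6 (p. 1577)] -/
theorem isAdmissibleFor_bentH₁ (hp : 2 ≤ p) (hq : m * p + 1 ≤ p ^ c) :
    IsAdmissibleFor (bentWeights₁ p m) (bentH₁ k p m c) := by
  classical
  have hp1 : 1 ≤ p := by omega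
  rw [isAdmissibleFor_iff_le_monomialOrd _ (bentW p m) (N := p * (m * p + 1)) (by positivity)
    (bentW_eq_mul_bentWeights₁₄₅ hp1 m), le_monomialOrd_iff]
  intro d hd
  have h0 : bentW p m 0 = 0 := by simp [bentW]
  have h1 : bentW p m 1 = m * p + 1 := by simp [bentW]
  have h2 : bentW p m 2 = p := by simp [bentW]
  have h3 : bentW p m 3 = p := by simp [bentW]
  rcases (by simpa only [Finset.mem_insert, Finset.mem_singleton] using support_bentH₁_subset p m c hd :
      d = _ ∨ d = _ ∨ d = _) with rfl | rfl | rfl <;>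
    rw [weight_expFin4, h0, h1, h2, h3]
  · simp only [zero_mul, zero_add]
    rw [mul_comm (p ^ c) p]
    exact Nat.mul_le_mul_left p hq
  · simp only [zero_mul, zero_add, add_zero]
    rw [mul_comm]
  · have : m * p * p + 1 * p = p * (m * p + 1) := by ring
    omega

variable (k) in
/-- **The `T`-tight centre `(Ψ_T, γ₁)` is a centre for `F₁`.** (derived here)
[cite: AbramovichTemkinWlodarczyk2024, Thm. 5.3.1 (2) (p. 1578)] -/
theorem isCentreFor_tight₁ [hp : Fact p.Prime] [CharP k p] (hq : m * p + 1 ≤ p ^ c) :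
    IsCentreFor (bentF₁ k p m c) (tightShear k p c) (bentWeights₁ p m) := by
  refine ⟨constantCoeff_tightShear_X hp.out.one_lt.le c, bentWeights₁_nonneg₄₅ p m, ?_⟩
  rw [tightShear_symm_bentF₁]
  exact isAdmissibleFor_bentH₁ hp.out.two_le hq

variable (k) in
/-- **The bent centre `(Ψ_B, γ₁)` is a centre for `F₁`.** (derived here; the cell's `Z_B` for `a = 1`)
[cite: AbramovichTemkinWlodarczyk2024, Thm. 5.3.1 (2) (p. 1578)] [cite: Hauser2010, §D (p. 12)] -/
theorem isCentreFor_bent₁ [hp : Fact p.Prime] [CharP k p] (hq : m * p + 1 ≤ p ^ c) :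
    IsCentreFor (bentF₁ k p m c) (bentShear k p m) (bentWeights₁ p m) := by
  refine ⟨constantCoeff_bentShear_X hp.out.one_lt.le m, bentWeights₁_nonneg₄₅ p m, ?_⟩
  rw [bentShear_symm_bentF₁]
  exact isAdmissibleFor_bentH₁ hp.out.two_le hq

/-- **The identity centre `(id, γ₁)` is a centre for `h₁`** over every field. (derived here)
[cite: AbramovichTemkinWlodarczyk2024, Thm. 5.3.1 (2) (p. 1578)] -/
theorem isCentreFor_bentH₁_refl (hp : 2 ≤ p) (hq : m * p + 1 ≤ p ^ c) :
    IsCentreFor (bentH₁ k p m c) AlgEquiv.refl (bentWeights₁ p m) := by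
  refine ⟨fun i => by simp, bentWeights₁_nonneg₄₅ p m, ?_⟩
  rw [AlgEquiv.refl_symm, AlgEquiv.coe_refl, id]
  exact isAdmissibleFor_bentH₁ hp hq

/-- **`(p, mp+1, mp+1) ∈ W(h₁)`** over every field. (derived here) [cite: AbramovichTemkinWlodarczyk2024, Thm. 5.3.1 (2)] -/
theorem bentH₁_mem_admissibleInvariants (hp : 2 ≤ p) (hm : 1 ≤ m) (hq : m * p + 1 ≤ p ^ c) :
    [(p : ℚ), ((m * p + 1 : ℕ) : ℚ), ((m * p + 1 : ℕ) : ℚ)] ∈ admissibleInvariants (bentH₁ k p m c) := by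
  rw [← exps_bentWeights₁ (by omega) hm]
  exact exps_mem_admissibleInvariants (isCentreFor_bentH₁_refl hp hq)

/-! ### §1.4 `T`-tightness: `Ψ_T` is `T`-tight, `Ψ_B` is not -/

/-- `v_γ(X_i^n) = n γ_i` (plumbing). [cite: AbramovichTemkinWlodarczyk2024, §2.4] -/
private theorem monomialValuation_single₄₅ (γ : Fin 4 → ℚ) (i : Fin 4) (n : ℕ) :
    monomialValuation γ (Finsupp.single i n) = n * γ i := by
  classical
  rw [monomialValuation, Finsupp.sum_single_index]
  simp

/-- **`Ψ_T` is `T`-tight**: its only `x`-term is `x^{q/p}` in `Ψ_T⁻¹ y1 = y1 − x^{q/p}`, of split value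
`(q/p)/q = 1/p = γ₁(y1)`. (derived here) [cite: CossartJannsenSaito2020, Thm. 8.16 (p. 121)] -/
theorem isTTight_tightShear (hp : 1 ≤ p) (m c : ℕ) :
    IsTTight (p ^ (c + 1)) 0 (tightShear k p c) (bentWeights₁ p m) := by
  classical
  intro i d hd hpos
  by_cases hi : i = 1
  · subst hi
    rw [tightShear_symm_X_one] at hd
    have hd' := support_sub (σ := Fin 4) (R := k) _ _ hd
    rw [Finset.mem_union, support_X, support_X_pow, Finset.mem_singleton, Finset.mem_singleton] at hd'
    rcases hd' with rfl | rfl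
    · simp at hpos
    · rw [monomialValuation_single₄₅, Function.update_self, bentWeights₁_one]
      push_cast
      rw [pow_succ, one_div, mul_inv, ← mul_assoc, mul_inv_cancel₀ (by positivity), one_mul]
  · rw [tightShear_symm_X_of_ne p c hi, support_X, Finset.mem_singleton] at hd
    subst hd
    have hi0 : i = 0 := by
      by_contra h
      simp [Ne.symm h] at hpos
    subst hi0
    rw [bentWeights₁_zero, monomialValuation_single₄₅, Function.update_self]
    positivity

/-- **The bent centre is not `T`-tight** (for `a = 1`): `x·y2^m` in `Ψ_B⁻¹ y1` has split value
`1/q + m/(mp+1) < 1/p` iff `q > p(mp+1)`. (derived here) [cite: Hauser2010, §D (p. 12)]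
[cite: CossartJannsenSaito2020, Thm. 8.16 (p. 121)] -/
theorem not_isTTight_bent₁ (hp : 2 ≤ p) (hm : 1 ≤ m) (hq : m * p + 1 < p ^ c) :
    ¬ IsTTight (p ^ (c + 1)) 0 (bentShear k p m) (bentWeights₁ p m) := by
  classical
  intro h
  have hmon : (X 0 * X 2 ^ m : MvPolynomial (Fin 4) k) = monomial (expFin4 1 0 m 0) 1 := by
    rw [monomial_expFin4]; simp
  have hX1 : (X 1 : MvPolynomial (Fin 4) k) = monomial (expFin4 0 1 0 0) 1 := by
    rw [monomial_expFin4]; simp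
  have hmem : expFin4 1 0 m 0 ∈ ((bentShear k p m).symm (X 1)).support := by
    rw [bentShear_symm_X_one, hmon, hX1, mem_support_iff, coeff_sub, coeff_monomial, coeff_monomial, if_neg,
      if_pos rfl]
    · norm_num
    · rw [expFin4_eq_iff]; omega
  have hle := h 1 _ hmem (by simp)
  rw [monomialValuation_expFin4] at hle
  simp only [Function.update_self, Function.update_of_ne (show (1 : Fin 4) ≠ 0 by decide),
    Function.update_of_ne (show (2 : Fin 4) ≠ 0 by decide), Function.update_of_ne (show (3 : Fin 4) ≠ 0 by decide),
    bentWeights₁_one, bentWeights₁_two, Nat.cast_zero, Nat.cast_one, zero_mul, add_zero, one_mul] at hle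
  -- `hle : p⁻¹ ≤ 1/q + m/(mp+1)`; but `q > p (mp+1)` says the opposite
  have hM : (0 : ℚ) < ((m * p + 1 : ℕ) : ℚ) := by positivity
  have hν : (0 : ℚ) < (p : ℚ) := by positivity
  have hq' : (0 : ℚ) < ((p ^ (c + 1) : ℕ) : ℚ) := by positivity
  have key : ((m * p + 1 : ℕ) : ℚ) * (p : ℚ) + (m : ℚ) * ((p ^ (c + 1) : ℕ) : ℚ) * (p : ℚ)
      < ((p ^ (c + 1) : ℕ) : ℚ) * ((m * p + 1 : ℕ) : ℚ) := by
    have h1 : (m * p + 1) * p + m * p ^ (c + 1) * p < p ^ (c + 1) * (m * p + 1) := by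
      have h2 : (m * p + 1) * p < p ^ (c + 1) := by
        rw [pow_succ]
        exact Nat.mul_lt_mul_of_pos_right hq (by omega)
      have : p ^ (c + 1) * (m * p + 1) = m * p ^ (c + 1) * p + p ^ (c + 1) := by ring
      omega
    exact_mod_cast h1
  have h1 : ((p ^ (c + 1) : ℕ) : ℚ) * ((m * p + 1 : ℕ) : ℚ) * (p : ℚ) * (p : ℚ)⁻¹
      = ((p ^ (c + 1) : ℕ) : ℚ) * ((m * p + 1 : ℕ) : ℚ) := mul_inv_cancel_right₀ hν.ne' _
  have h2 : ((p ^ (c + 1) : ℕ) : ℚ) * ((m * p + 1 : ℕ) : ℚ) * (p : ℚ) *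
      (1 / ((p ^ (c + 1) : ℕ) : ℚ) + (m : ℚ) * (((m * p + 1 : ℕ) : ℚ))⁻¹)
      = ((m * p + 1 : ℕ) : ℚ) * (p : ℚ) + (m : ℚ) * ((p ^ (c + 1) : ℕ) : ℚ) * (p : ℚ) := by
    field_simp
  have hle' := mul_le_mul_of_nonneg_left hle (le_of_lt (mul_pos (mul_pos hq' hM) hν))
  rw [h1, h2] at hle'
  linarith

end RankOne

/-! ## §2 Order, initial form, `δ`, `δ`-face and `τ` of `h₁` — characteristic-free -/

section NewtonDataOne

variable {p m c : ℕ}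

/-- `in_ν` of a monomial (plumbing). [folklore] -/
private theorem homogeneousComponent_monomial₄₅' (n : ℕ) (e : Fin 4 →₀ ℕ) :
    homogeneousComponent n (monomial e (1 : k)) = if n = e.degree then monomial e 1 else 0 :=
  homogeneousComponent_of_mem ((mem_homogeneousSubmodule _ _).2 (isHomogeneous_monomial 1 rfl))

/-- **`ord h₁ = p`**: the degrees of the three monomials are `q/p, p, mp+1 ≥ p`. (derived here)
[cite: AbramovichTemkinWlodarczyk2024, Lemma 5.2.10 (p. 1577)] -/
theorem monomialOrd_one_bentH₁ (hp : 2 ≤ p) (hm : 1 ≤ m) (hq : m * p + 1 < p ^ c) :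
    monomialOrd (fun _ => 1) (bentH₁ k p m c) = ((p : ℕ) : ℕ∞) := by
  classical
  have hmp : p ≤ m * p := Nat.le_mul_of_pos_left p hm
  apply le_antisymm
  · have h := monomialOrd_le_weight (fun _ : Fin 4 => 1) (F := bentH₁ k p m c) (d := expFin4 0 p 0 0)
      (by rw [mem_support_iff, coeff_e1_bentH₁₄₅ hp]; exact one_ne_zero)
    rw [weight_expFin4] at h
    simpa using h
  · rw [le_monomialOrd_iff]
    intro d hd
    rcases (by simpa only [Finset.mem_insert, Finset.mem_singleton] using support_bentH₁_subset p m c hd :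
        d = _ ∨ d = _ ∨ d = _) with rfl | rfl | rfl <;>
      rw [weight_expFin4] <;> simp only [mul_one, zero_add, add_zero] <;> omega

/-- **`in_p h₁ = y1^p`** (block `S = {y1}`). (derived here) [cite: CossartJannsenSaito2020, Def. 1.26 / Lemma 1.27] -/
theorem homogeneousComponent_bentH₁ (hm : 1 ≤ m) (hq : m * p + 1 < p ^ c) :
    homogeneousComponent p (bentH₁ k p m c) = X 1 ^ p := by
  classical
  have hmp : p ≤ m * p := Nat.le_mul_of_pos_left p hm
  have hX : (X 1 ^ p : MvPolynomial (Fin 4) k) = monomial (expFin4 0 p 0 0) 1 := by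
    rw [monomial_expFin4]; simp
  have H0 : homogeneousComponent p (monomial (expFin4 0 0 0 (p ^ c)) (1 : k)) = 0 := by
    rw [homogeneousComponent_monomial₄₅', degree_expFin4, if_neg (by omega)]
  have H1 : homogeneousComponent p (monomial (expFin4 0 p 0 0) (1 : k)) = monomial (expFin4 0 p 0 0) 1 := by
    rw [homogeneousComponent_monomial₄₅', degree_expFin4, if_pos (by omega)]
  have H2 : homogeneousComponent p (monomial (expFin4 0 0 (m * p) 1) (1 : k)) = 0 := by
    rw [homogeneousComponent_monomial₄₅', degree_expFin4, if_neg (by omega)]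
  rw [bentH₁_eq_monomial, map_add, map_sub, H0, H1, H2, hX]
  simp

/-- **`δ(h₁; x, y2, y3; y1) = (mp+1)/p`**: the ratios `|A|/(p − |B|)` are `p^c/p > δ` at `y3^{q/p}` and `= δ` at
`y2^{mp} y3`. (derived here) [cite: CossartJannsenSaito2020, Def. 8.1 (3) / Def. 8.2 (1) (pp. 117–118)] -/
theorem hironakaDelta_bentH₁ (hp : 2 ≤ p) (hq : m * p + 1 < p ^ c) :
    hironakaDelta ({1} : Finset (Fin 4)) p (bentH₁ k p m c) = ((((m * p + 1 : ℕ) : ℚ) / (p : ℚ) : ℚ) : WithTop ℚ) := by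
  classical
  have he2 : expFin4 0 0 (m * p) 1 ∈ (bentH₁ k p m c).support := by
    rw [mem_support_iff, coeff_e2_bentH₁₄₅ hp hq]; norm_num
  apply le_antisymm
  · unfold hironakaDelta
    refine (Finset.inf_le (Finset.mem_filter.2 ⟨he2, ?_⟩)).trans (le_of_eq ?_)
    · rw [blockDeg_one_expFin4]; omega
    · rw [coDeg_one_expFin4, blockDeg_one_expFin4, Nat.sub_zero, zero_add]
  · rw [le_hironakaDelta_iff]
    intro d hd hb
    rcases (by simpa only [Finset.mem_insert, Finset.mem_singleton] using support_bentH₁_subset p m c hd :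
        d = _ ∨ d = _ ∨ d = _) with rfl | rfl | rfl
    · rw [coDeg_one_expFin4, blockDeg_one_expFin4, Nat.sub_zero, zero_add, zero_add]
      exact div_le_div_of_nonneg_right (by exact_mod_cast hq.le) (by positivity)
    · rw [blockDeg_one_expFin4] at hb
      exact absurd hb (lt_irrefl _)
    · rw [coDeg_one_expFin4, blockDeg_one_expFin4, Nat.sub_zero, zero_add]

/-- **`in_δ h₁ = ℓ`**: `y1^p` and `y2^{mp} y3` are on the `δ`-face, `y3^{q/p}` strictly above it. (derived here)
[cite: CossartJannsenSaito2020, Def. 8.2 (4) (p. 118)] -/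
theorem deltaInitial_bentH₁ (hp : 2 ≤ p) (hq : m * p + 1 < p ^ c) :
    deltaInitial ({1} : Finset (Fin 4)) p (((m * p + 1 : ℕ) : ℚ) / (p : ℚ)) (bentH₁ k p m c) = bentEll k p m := by
  classical
  have hν : (p : ℚ) ≠ 0 := by positivity
  have hface : bentEll k p m = bentH₁ k p m c - monomial (expFin4 0 0 0 (p ^ c)) 1 := by
    rw [bentH₁, monomial_expFin4]; simp
  have P1 : blockDeg ({1} : Finset (Fin 4)) (expFin4 0 p 0 0) ≤ p ∧
      ((coDeg ({1} : Finset (Fin 4)) (expFin4 0 p 0 0) : ℚ) =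
        ((m * p + 1 : ℕ) : ℚ) / (p : ℚ) * (((p - blockDeg ({1} : Finset (Fin 4)) (expFin4 0 p 0 0) : ℕ) : ℚ))) := by
    rw [blockDeg_one_expFin4, coDeg_one_expFin4]; simp
  have P2 : blockDeg ({1} : Finset (Fin 4)) (expFin4 0 0 (m * p) 1) ≤ p ∧
      ((coDeg ({1} : Finset (Fin 4)) (expFin4 0 0 (m * p) 1) : ℚ) =
        ((m * p + 1 : ℕ) : ℚ) / (p : ℚ) * (((p - blockDeg ({1} : Finset (Fin 4)) (expFin4 0 0 (m * p) 1) : ℕ) : ℚ))) := by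
    rw [blockDeg_one_expFin4, coDeg_one_expFin4, Nat.sub_zero, div_mul_cancel₀ _ hν, zero_add]
    exact ⟨Nat.zero_le _, by push_cast; ring⟩
  have P0 : ¬ (blockDeg ({1} : Finset (Fin 4)) (expFin4 0 0 0 (p ^ c)) ≤ p ∧
      ((coDeg ({1} : Finset (Fin 4)) (expFin4 0 0 0 (p ^ c)) : ℚ) =
        ((m * p + 1 : ℕ) : ℚ) / (p : ℚ) * (((p - blockDeg ({1} : Finset (Fin 4)) (expFin4 0 0 0 (p ^ c)) : ℕ) : ℚ)))) := by
    rw [blockDeg_one_expFin4, coDeg_one_expFin4, Nat.sub_zero, div_mul_cancel₀ _ hν, zero_add, zero_add]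
    rintro ⟨-, h⟩
    have : p ^ c = m * p + 1 := by exact_mod_cast h
    omega
  ext d
  rw [coeff_deltaInitial, hface, coeff_sub, coeff_monomial]
  by_cases hd : d ∈ (bentH₁ k p m c).support
  · rcases (by simpa only [Finset.mem_insert, Finset.mem_singleton] using support_bentH₁_subset p m c hd :
        d = _ ∨ d = _ ∨ d = _) with rfl | rfl | rfl
    · rw [if_neg P0, if_pos rfl, coeff_bentH₁, if_pos rfl, if_neg, if_neg]
      · norm_num
      all_goals (rw [expFin4_eq_iff]; omega)
    · rw [if_pos P1, if_neg, sub_zero]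
      rw [expFin4_eq_iff]; omega
    · rw [if_pos P2, if_neg, sub_zero]
      rw [expFin4_eq_iff]; omega
  · have h0 : coeff d (bentH₁ k p m c) = 0 := by rwa [mem_support_iff, not_not] at hd
    rw [h0, ite_self, if_neg, sub_zero]
    rintro rfl
    exact hd (mem_support_iff.2 (by
      rw [coeff_bentH₁, if_pos rfl, if_neg, if_neg]
      · norm_num
      all_goals (rw [expFin4_eq_iff]; omega)))

/-- `ℓ ∈ k[y1, y2, y3]` (plumbing). [folklore] -/
private theorem vars_bentEll_subset₄₅ (p m : ℕ) : (bentEll k p m).vars ⊆ {1, 2, 3} := by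
  classical
  have h1 : (X 1 ^ p : MvPolynomial (Fin 4) k).vars ⊆ {1, 2, 3} :=
    (vars_pow _ _).trans (by rw [vars_X]; decide)
  have h2 : (X 2 ^ (m * p) : MvPolynomial (Fin 4) k).vars ⊆ {1, 2, 3} :=
    (vars_pow _ _).trans (by rw [vars_X]; decide)
  have h3 : (X 3 : MvPolynomial (Fin 4) k).vars ⊆ {1, 2, 3} := by rw [vars_X]; decide
  rw [bentEll]
  exact (vars_sub_subset _).trans (Finset.union_subset h1 ((vars_mul _ _).trans (Finset.union_subset h2 h3)))

/-- The value of `ℓ` at a point (plumbing). [folklore] -/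
private theorem aeval_bentEll₄₅ (y : Fin 4 → k) : aeval y (bentEll k p m) = y 1 ^ p - y 2 ^ (m * p) * y 3 := by
  simp [bentEll, map_sub, map_mul, map_pow, aeval_X]

/-- **`τ(ℓ) = 3` over EVERY field**: translation invariance at the points `0`, `e₃`, `e₂` forces `w₁ = w₂ = w₃ = 0`.
(derived here, after `WeightedCentreStepUmbrella.hironakaTau_umbrella`) [cite: CossartJannsenSaito2020, Def. 1.26 / Lemma 1.27] -/
theorem hironakaTau_bentEll (hp : 2 ≤ p) (hm : 1 ≤ m) : hironakaTau k {bentEll k p m} = 3 := by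
  classical
  have hp0 : p ≠ 0 := by omega
  have hmp : m * p ≠ 0 := by positivity
  rw [show (3 : ℕ) = ({1, 2, 3} : Finset (Fin 4)).card by rfl]
  refine hironakaTau_singleton_eq_card (vars_bentEll_subset₄₅ p m) fun w hw x hx => ?_
  have h0 := aeval_eq_of_mem_invarianceSpace hw (fun _ => (0 : k)) 1
  have h1 := aeval_eq_of_mem_invarianceSpace hw (Pi.single 3 1) 1
  have h2 := aeval_eq_of_mem_invarianceSpace hw (Pi.single 2 1) 1
  simp only [aeval_bentEll₄₅, zero_add, mul_one, zero_pow hp0, zero_pow hmp, zero_mul, sub_zero] at h0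
  simp only [aeval_bentEll₄₅, Pi.single_eq_same, Pi.single_eq_of_ne (show (1 : Fin 4) ≠ 3 by decide),
    Pi.single_eq_of_ne (show (2 : Fin 4) ≠ 3 by decide), zero_add, mul_one, zero_pow hp0, zero_pow hmp,
    sub_zero] at h1
  simp only [aeval_bentEll₄₅, Pi.single_eq_same, Pi.single_eq_of_ne (show (1 : Fin 4) ≠ 2 by decide),
    Pi.single_eq_of_ne (show (3 : Fin 4) ≠ 2 by decide), zero_add, mul_one, zero_pow hp0, one_pow,
    mul_zero, sub_zero] at h2
  have hw2 : w 2 = 0 := by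
    have : w 2 ^ (m * p) = 0 := by linear_combination h0 - h1
    exact (pow_eq_zero_iff hmp).1 this
  have hw1 : w 1 = 0 := by
    rw [hw2, zero_pow hmp, zero_mul, sub_zero] at h0
    exact (pow_eq_zero_iff hp0).1 h0
  have hw3 : w 3 = 0 := by
    simp only [hw1, hw2, zero_pow hp0, add_zero, one_pow, one_mul, zero_sub, neg_eq_zero] at h2
    exact h2
  simp only [Finset.mem_insert, Finset.mem_singleton] at hx
  rcases hx with rfl | rfl | rfl
  exacts [hw1, hw2, hw3]

/-- `(mp+1)/p ∉ ℕ` for `p ≥ 2` (plumbing). [folklore] -/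
private theorem natCast_ne_delta₁₄₅ (hp : 2 ≤ p) (m q : ℕ) : (q : ℚ) ≠ ((m * p + 1 : ℕ) : ℚ) / (p : ℚ) := by
  intro h
  have hν : (p : ℚ) ≠ 0 := by positivity
  rw [eq_div_iff hν] at h
  have h2 : q * p = m * p + 1 := by exact_mod_cast h
  have h3 : p ∣ 1 := (Nat.dvd_add_right (dvd_mul_left p m)).1 (h2 ▸ dvd_mul_left p q)
  have := Nat.le_of_dvd one_pos h3
  omega

end NewtonDataOne

/-! ## §3 `max W(F₁) = (p, mp+1, mp+1)`, attained by a `T`-tight and by a bent centre -/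

section MaxOne

variable {p m c : ℕ}

/-- **`max W(h₁) = (p, mp+1, mp+1)` over EVERY field** (`p ≥ 2` any integer, `m ≥ 1`, `p^c > mp+1`): the
`(ν, M, M)` pattern with `ν = p`, `δ = (mp+1)/p ∉ ℕ`, `τ(in_δ) = τ(ℓ) = 3`. (derived here)
[cite: CossartJannsenSaito2020, Thm. 8.16 (p. 121), Thm. 8.22 (a) (p. 124)]
[cite: AbramovichTemkinWlodarczyk2024, Thm. 5.3.1 (2)–(3) (p. 1578)] -/
theorem isMaxInv_bentH₁ (hp : 2 ≤ p) (hm : 1 ≤ m) (hq : m * p + 1 < p ^ c) :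
    IsMaxInv (admissibleInvariants (bentH₁ k p m c)) [(p : ℚ), ((m * p + 1 : ℕ) : ℚ), ((m * p + 1 : ℕ) : ℚ)] := by
  have hmp : p ≤ m * p := Nat.le_mul_of_pos_left p hm
  exact isMaxInv_triple_of_forall_natCast_ne (monomialOrd_one_bentH₁ hp hm hq) (homogeneousComponent_bentH₁ hm hq)
    (by omega) (by exact_mod_cast Nat.lt_succ_of_le hmp) (hironakaDelta_bentH₁ hp hq)
    (natCast_ne_delta₁₄₅ hp m) (by rw [deltaInitial_bentH₁ hp hq, hironakaTau_bentEll hp hm])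
    (bentH₁_mem_admissibleInvariants hp hm hq.le)

/-- **`max W(x^q + y3^{q/p} + y1^p − y2^{mp} y3) = (p, mp+1, mp+1)`** in characteristic `p`, every prime `p`,
`m ≥ 1`, `q = p^{c+1} > p(mp+1)`. (derived here; the cell's `a = 1` value) [cite: AbramovichTemkinWlodarczyk2024, Thm. 5.3.1 (2)–(3) (p. 1578)]
[cite: Hauser2010, §C (p. 9)] -/
theorem isMaxInv_bentF₁ [hp : Fact p.Prime] [CharP k p] (hm : 1 ≤ m) (hq : m * p + 1 < p ^ c) :
    IsMaxInv (admissibleInvariants (bentF₁ k p m c)) [(p : ℚ), ((m * p + 1 : ℕ) : ℚ), ((m * p + 1 : ℕ) : ℚ)] := by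
  rw [admissibleInvariants_bentF₁]
  exact isMaxInv_bentH₁ hp.out.two_le hm hq

/-- **Two maximal presentations of different type** (the cell's Theorem 3, typed for every prime `p`): `F₁` has a
`T`-tight centre AND a non-`T`-tight (bent) centre, with the same weights `γ₁`, both of maximal invariant
`(p, mp+1, mp+1)`.  (derived here; in the `a ≥ 2` family the bent centre is again maximal and not `T`-tight —
`WeightedCentreBentFamily.isMaxInv_bentF`, `not_isTTight_bent` — while the cell's hand proof that NO maximal centre is
`T`-tight there is not typed.) [cite: AbramovichTemkinWlodarczyk2024, Thm. 5.3.1 (2)–(3) (p. 1578)]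
[cite: Hauser2010, §D (p. 12)] [cite: AbramovichQuekSchober2025, Thm. 3.5] -/
theorem exists_isTTight_and_not_isTTight_centre [hp : Fact p.Prime] [CharP k p] (hm : 1 ≤ m)
    (hq : m * p + 1 < p ^ c) :
    ∃ (ΨT ΨB : MvPolynomial (Fin 4) k ≃ₐ[k] MvPolynomial (Fin 4) k) (γ : Fin 4 → ℚ),
      IsCentreFor (bentF₁ k p m c) ΨT γ ∧ IsCentreFor (bentF₁ k p m c) ΨB γ ∧
        IsMaxInv (admissibleInvariants (bentF₁ k p m c)) (exps γ) ∧
        IsTTight (p ^ (c + 1)) 0 ΨT γ ∧ ¬ IsTTight (p ^ (c + 1)) 0 ΨB γ :=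
  ⟨tightShear k p c, bentShear k p m, bentWeights₁ p m, isCentreFor_tight₁ k hq.le, isCentreFor_bent₁ k hq.le,
    by rw [exps_bentWeights₁ hp.out.one_lt.le hm]; exact isMaxInv_bentF₁ hm hq,
    isTTight_tightShear hp.out.one_lt.le m c, not_isTTight_bent₁ hp.out.two_le hm hq⟩

/-- **The cell's example** `(p, m, q) = (2, 1, 8)`: over any field of characteristic `2`,
`max W(x^8 + y3^4 + y1^2 + y2^2 y3) = (2, 3, 3)` (signs immaterial), attained by the `T`-tight centre
`(y1 + x^4, y2, y3; 1/2, 1/3, 1/3)` and by the bent centre `(y1 + x y2, y2, y3 + x²; 1/2, 1/3, 1/3)`. (derived here;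
engine-1 gen 28, Theorem 3) [cite: AbramovichTemkinWlodarczyk2024, Thm. 5.3.1 (2)–(3) (p. 1578)] [cite: Hauser2010, §D (p. 12)] -/
theorem isMaxInv_bent_2_1_1_8 (k : Type*) [Field k] [CharP k 2] :
    IsMaxInv (admissibleInvariants (X 0 ^ 8 + (X 3 ^ 4 + (X 1 ^ 2 + X 2 ^ 2 * X 3)) : MvPolynomial (Fin 4) k))
      [(2 : ℚ), 3, 3] := by
  haveI : Fact (Nat.Prime 2) := ⟨Nat.prime_two⟩
  have h := isMaxInv_bentF₁ (k := k) (p := 2) (m := 1) (c := 2) le_rfl (by norm_num)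
  simp only [bentF₁, bentH₁, bentEll, CharTwo.sub_eq_add] at h
  norm_num at h
  exact h

end MaxOne

end Literature.AlgebraicGeometry.Resolution.WeightedBlowup
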